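import Summits.QuantumFields.YangMills.Theorems.FluctuationComparisonRegPrIntLS2BetaHFlatOfKeyLemma
import Summits.QuantumFields.YangMills.Theorems.FluctuationComparisonRegPrIntLS2BetaKeyLemmaRecordE2E
import HarnessLib

/-!
# S2β · `hFlat` road (UV3-NODE §57.8 (B)) — `hFlat` OUTRIGHT: THE DEPTH-UNIFORM FLAT LETTER OF GAP♯∘ IS A THEOREM
# `hFlat_holds : ⟨hFlat — ✓p811100 (D10)'s third hypothesis, VERBATIM⟩`

Cell `ym3-torus` (YM ladder rung R3 = continuum `SU(2)` Yang–Mills on the three-torus — a RUNG: NOT d = 4, NOT infinite volume, NOT a mass gap,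
NOT Clay).  Width seat «width 17» `ym3-torus-px17` (gen 19), FREE px helper on crux `stmt-QuantumFields-20520`
(`Theses.UnitScaleTilt.FluctuationComparisonRegPrIntL`); `--kind proof --supports stmt-QuantumFields-20520 --as helper`, count-neutral, DEFINITION-FREE
(0 `def`, 0 `instance`, 0 `notation`, 0 `sorry`, default heartbeats).

WHAT.  ONE TERM: ✓`hFlat_of_keyLemma` (px17 g19, the grand assembly: ENTRY ✓p815840 ∘ door ✓p816498 (stage tower ✓p816142) ∘ feeders ✓p817191 with
F2 px13 ✓p816657, F3 px12 ✓`sum_plaq_dist1_lift_sq_le`, F4 px21 ✓`sqrt_sum_dist1_spine_sq_le`, S ✓p817429, (R1) px12 ✓p815895) APPLIED TO px13 g23's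
★★★★✓`keyLemma_record` (F1 = the nonabelian KEY LEMMA on the T³ record: px8 G11 `keyLemma_tower_sqrtL` ∘ px12 g23 ✓p816714 `tentKernel_schur` ∘ px10 g22
✓p817736 `oneLevelStep`).  The conclusion is the third hypothesis `hFlat` of ✓p811100 `…S2BetaGapOrbitOfStrata.uniformFibreGapOrbit_of_strata_of_flat`
(registered organ GAP♯∘, `Lines/semiclassical_s2beta.lean` v11.4 :768∕:1387), CHARACTER-FOR-CHARACTER, with NO hypothesis left.

SO, FOR THE RECORD: of ✓(D10)'s three letters {`hIrr`, `hA`, `hFlat`} the flat one is DISCHARGED; GAP♯∘ (`stub_uniformFibreGapOrbit`) now follows from the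
two strata letters `hIrr`∕`hA` (TUBE-REG∘ side, UV3-NODE §54 — OPEN, untouched here) by ✓p811100.

HONEST SCOPE.  A one-term application of landed theorems (this seat's lineage + px13∕px10∕px12∕px21∕px8's F1 chain); the mathematics is px8 g21's
elementary telescoping replacement of [Balaban1984PropagatorsI] Prop. 1.1 (1.89)–(1.90) p.33 ∕ [Balaban1984PropagatorsII] Prop. 2.2 (2.67) p.234 on the
flat stratum, with [Balaban1985RegularSpaces] (1.29) p.81, (1.65) p.87 as the printed loci of the axial-gauge tower.  NOT proved here or anywhere yet:
`hIrr`, `hA`, TUBE-REG∘, GAP♯∘ (`stub_uniformFibreGapOrbit`), EXW∘, DET-REP-B, H4ᶜ∘, LFR♯ᶜ∘, S2β, the five registered stubs (0∕5 moved), crux 20520, 19936,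
19200, `B8Thm2AtT3Members` at `L = 3`, `YM3TorusSU2`; no registered stub is closed by a helper; rung R3 = SU(2) YM₃ on T³ at fixed lattice data — NOT d = 4,
NOT infinite volume, NOT a mass gap, NOT Clay; the Yang–Mills mass gap is NOT proved.
References: T. Bałaban, CMP **95** (1984) 17–40 [Balaban1984PropagatorsI]; CMP **96** (1984) 223–250 [Balaban1984PropagatorsII]; CMP **99** (1985) 75–102
[Balaban1985RegularSpaces]; CMP **102** (1985) 255–275 [Balaban1985UV3] ((7) p.257).
-/

set_option autoImplicit false

namespace Summit.QuantumFields.YangMills.Theorems.FluctuationComparisonRegPrIntLS2BetaHFlat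

open Finset
open Literature.MathematicalPhysics.QuantumFieldTheory.Balaban1983to89
open T4Continuum T3ContinuumYM3Torus T3UnitScaleTilt T3TiltDescent T3LevelShift BlockAveraging
open T4CubeChartGnomonic (SU2)
open T3UnitLawDensityEML (ℰp)
open T3ConstrainedMinimiser (fibre)
open T3PrintedRegularMinimiser (minActionRegPr)
open Summit.QuantumFields.YangMills.Theorems.FluctuationComparisonRegPrIntLS2BetaHFlatOfKeyLemma (hFlat_of_keyLemma)
open Summit.QuantumFields.YangMills.Theorems.FluctuationComparisonRegPrIntLS2BetaKeyLemmaRecordE2E (keyLemma_record)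

/-- ★★★★★ **`hFlat` OUTRIGHT.**  The depth-uniform flat letter of the registered stiffness organ GAP♯∘ — the third hypothesis `hFlat` of ✓p811100
`uniformFibreGapOrbit_of_strata_of_flat`, VERBATIM: for every block size `L` there are `pS` (here `0`), and for all `b₀ > 0`, `p₀ ≥ pS`, `p₀ > 0` an
`ε₁ > 0` (here `1`), and for every `0 < ε₀ ≤ ε₁` a history threshold `γ₁ > 0` and a STIFFNESS CONSTANT `μ > 0` — functions of `(L, b₀, p₀)` only, NOT of the
depth `K − J` nor of the volume — such that on every fibre over the trivial window datum inside the balanced history-good set the Wilson action excess over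
the regularised fibre minimum dominates `μ·L^{−2(K−J)}·` the squared `dist1`-distance to the residual-gauge orbit of `1`.  Proof: ONE TERM,
✓`hFlat_of_keyLemma` applied to px13 g23's ✓`keyLemma_record`. [cite: Balaban1984PropagatorsI, Prop. 1.1 (1.89)-(1.90) p.33; Balaban1985RegularSpaces, (1.29) p.81, (1.65) p.87] -/
theorem hFlat_holds :
    ∀ (L : ℕ), ∃ pS : ℝ, ∀ (b₀ p₀ : ℝ), 0 < b₀ → pS ≤ p₀ → 0 < p₀ → ∃ ε₁ : ℝ, 0 < ε₁ ∧ ∀ (ε₀ : ℝ), 0 < ε₀ → ε₀ ≤ ε₁ →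
    ∃ γ₁ : ℝ, 0 < γ₁ ∧ ∃ μ : ℝ, 0 < μ ∧ ∀ (F : T3Family) (γ : ℝ), F.L = L → 0 < γ → γ ≤ γ₁ →
      ∀ (J K : ℕ) (hlt : J < K),
        ∀ U ∈ fibre F ℰp J K hlt.le (1 : GaugeField (F.P J) 0 SU2), U ∈ histGood F ℰp (θBal F.L γ b₀ p₀) K J →
          μ * ((F.L : ℝ)⁻¹) ^ (2 * (K - J)) *
              (⨅ w : {w : Site (F.P K) 0 → SU2 |
                  ∀ U : GaugeField (F.P K) 0 SU2,
                    descendTo F ℰp J K hlt.le (GaugeField.gaugeAct w U) = descendTo F ℰp J K hlt.le U},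
                ∑ ℓ : PBond (F.P K) 0,
                  dist1 (U ℓ * ((GaugeField.gaugeAct (w : Site (F.P K) 0 → SU2) (1 : GaugeField (F.P K) 0 SU2)) ℓ)⁻¹) ^ 2)
            ≤ wilsonAction4 U - minActionRegPr F J K hlt.le ε₀ (1 : GaugeField (F.P J) 0 SU2) :=
  hFlat_of_keyLemma keyLemma_record

end Summit.QuantumFields.YangMills.Theorems.FluctuationComparisonRegPrIntLS2BetaHFlat
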